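import Summits.QuantumAdvantage.QuantumAdvantage.Theorems.AnchorDialOrbit

/-!
# AnchorDial — Count (cell decomp-qadv, seat lens-2, generation 14 rev 2; supports item 26531 `ExactnessDial.PolyLossOddU3`)

§8 of the node: the **COUNTING SHELL** of the engine for the crux `MovingPointerLoss3`, every hypothesis explicit.  `anc` / `CW` / `UB`
(declared anchors, certified win, instability — the summands of the crux), `zvec`/`gvec`/`xor4`, `Zset` (compatible raw-sign classes of a
datum), **`full_mem`** (orbit laws ⇒ a fully winning good input has its sign vector in the class of its datum), **`unst_cover`** (instability
telescopes along the orbit), **`card_big_le`** (class count from the one-sided equidistribution hypothesis EQUI) and **`count_shell`**: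
`32·#odd ≤ 32·#non-unique + 512·Σ_i #unstable_i + 32·#site-anchored + 10·2^n + 320·|Δ|·η + 512·#losers`.
Left to a prover (docstring of `count_shell`): (E1) the polynomial datum map and its degree, (E2) EQUI by a five-block Smolensky chain,
(E3) placement averaging, (E4) asymptotic assembly.

Split (≤ 400 lines, part 5/5) of the node file `HOME/decomp-qadv-lens-2/g14/AnchorDial.lean` (rev 2; sha256 in SHA256SUMS.txt, farm rc 0, no
placeholders); declarations verbatim, namespace `Summit.QuantumAdvantage.QuantumAdvantage.Theorems.AnchorDial`.  Record: NODE-g14.md.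
-/

set_option linter.dupNamespace false
set_option linter.unusedVariables false

noncomputable section

open scoped Classical

namespace Summit.QuantumAdvantage.QuantumAdvantage.Theorems.AnchorDial

open Finset
open Literature.Computability.QuantumComplexity Literature.Computability.QuantumComplexity.RingHLF
open Literature.Computability.MetaComplexity Literature.Computability.MetaComplexity.Smolensky
open Summit.QuantumAdvantage.AdviceFreeQNC0
-- only the tree gadgets we use (the g13 package keeps landing under `Theorems.HolonomyDial`; no blanket `open`)
open Summit.QuantumAdvantage.QuantumAdvantage.Theorems.HolonomyDial (gCond)

variable {N : ℕ}

/-! ## §8 The COUNTING SHELL of the engine for `MovingPointerLoss3` (every hypothesis explicit; the inputs left to a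
prover are named in the docstring of `count_shell`) -/

section Count

/-- the declared anchors of `x`. -/
def anc (A : Fin N → CubeFn (ZMod 3) N) (x : Fin N → Bool) : Finset (Fin N) := univ.filter fun k => A k x = 1

/-- certified win — the summand of `MovingPointerLoss3`'s conclusion. -/
def CW (A f : Fin N → CubeFn (ZMod 3) N) (x : Fin N → Bool) : Prop :=
  ∃ k : Fin N, anc A x = {k} ∧ gCond x ((k.val + (if f k x = 1 then 0 else 1)) % N)

/-- the instability predicate at site `a` — the summand of `MovingPointerLoss3`'s (STAB). -/
def UB (A : Fin N → CubeFn (ZMod 3) N) (a : ℕ) (y : Fin N → Bool) : Prop :=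
  OddZeros y ∧ ∃ k, ¬ (A k (flip2 a (a + 1) y) = 1 ↔ A k y = 1)

/-- AnchorDialCount helper `anc_ne_exists` (decomp-qadv land package; see the module docstring). -/
theorem anc_ne_exists {A : Fin N → CubeFn (ZMod 3) N} {y y' : Fin N → Bool} (h : anc A y ≠ anc A y') :
    ∃ k, ¬ (A k y = 1 ↔ A k y' = 1) := by
  by_contra hall
  push Not at hall
  exact h (filter_congr fun k _ => hall k)

/-- raw parity vector, gap vector, componentwise xor. -/
def zvec (b₁ b₂ b₃ b₄ : ℕ) (x : Fin N → Bool) : Core.B4 :=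
  (zpar x (b₁ + 1), zpar x (b₂ + 1), zpar x (b₃ + 1), zpar x (b₄ + 1))

/-- AnchorDialCount helper `gvec` (decomp-qadv land package; see the module docstring). -/
def gvec (b₁ b₂ b₃ b₄ k : ℕ) : Core.B4 :=
  (decide (b₁ + 1 ≤ k), decide (b₂ + 1 ≤ k), decide (b₃ + 1 ≤ k), decide (b₄ + 1 ≤ k))

/-- AnchorDialCount helper `xor4` (decomp-qadv land package; see the module docstring). -/
def xor4 (z g : Core.B4) : Core.B4 := (xor z.1 g.1, xor z.2.1 g.2.1, xor z.2.2.1 g.2.2.1, xor z.2.2.2 g.2.2.2)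

/-- AnchorDialCount helper `sgnVec_eq` (decomp-qadv land package; see the module docstring). -/
theorem sgnVec_eq (b₁ b₂ b₃ b₄ : ℕ) (x : Fin N → Bool) (k : ℕ) :
    sgnVec b₁ b₂ b₃ b₄ x k = xor4 (zvec b₁ b₂ b₃ b₄ x) (gvec b₁ b₂ b₃ b₄ k) := rfl

/-- AnchorDialCount helper `xor4_xor4` (decomp-qadv land package; see the module docstring). -/
theorem xor4_xor4 (z g : Core.B4) : xor4 (xor4 z g) g = z := by
  obtain ⟨z₁, z₂, z₃, z₄⟩ := z
  obtain ⟨g₁, g₂, g₃, g₄⟩ := g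
  simp [xor4]

/-- AnchorDialCount helper `sgnVec_zero` (decomp-qadv land package; see the module docstring). -/
theorem sgnVec_zero (b₁ b₂ b₃ b₄ : ℕ) (x : Fin N → Bool) : sgnVec b₁ b₂ b₃ b₄ x 0 = zvec b₁ b₂ b₃ b₄ x := by
  simp [sgnVec, zvec]

/-- AnchorDialCount helper `tsel_eq` (decomp-qadv land package; see the module docstring). -/
theorem tsel_eq (p : Prop) [Decidable p] : (if (!decide p) = true then 1 else 0 : ℕ) = if p then 0 else 1 := by
  by_cases hp : p <;> simp [hp]

variable {Δ : Type*}

/-- the compatible RAW-sign classes read off a datum `δ`: wrap anchors use `Core.Compat (wrapData s)`, the others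
`Core.Compat₂ 1 (ptrData s)` on effective signs, translated back to raw signs by the gap vector. -/
def Zset (sOf : Δ → (Core.B4 → Bool)) (gOf : Δ → Core.B4) (wOf : Δ → Bool) (δ : Δ) : Finset Core.B4 :=
  if wOf δ = true then univ.filter fun σ => Core.Compat (wrapData (sOf δ)) σ
  else (univ.filter fun σ => Core.Compat₂ 1 (ptrData (sOf δ)) σ).image fun σ => xor4 σ (gOf δ)

/-- AnchorDialCount helper `card_Zset_le` (decomp-qadv land package; see the module docstring). -/
theorem card_Zset_le (sOf : Δ → (Core.B4 → Bool)) (gOf : Δ → Core.B4) (wOf : Δ → Bool) (δ : Δ) :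
    (Zset sOf gOf wOf δ).card ≤ 10 := by
  unfold Zset
  split_ifs
  · exact (Core.card_compat_le_five _).trans (by norm_num)
  · exact card_image_le.trans (Core.core_four _ _)

/-- **orbit laws ⇒ class membership**: a uniquely anchored, orbit-stable input off the flip sites all sixteen of
whose orbit points are certified-winning has its raw sign vector in the compatible class of its datum (any datum map
that reads the selector bits, the gap vector and the wrap flag correctly on uniquely anchored inputs). -/
theorem full_mem (A f : Fin N → CubeFn (ZMod 3) N) {b₁ b₂ b₃ b₄ : ℕ} (h12 : b₁ + 2 ≤ b₂) (h23 : b₂ + 2 ≤ b₃)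
    (h34 : b₃ + 2 ≤ b₄) (h4N : b₄ + 3 ≤ N) (dat : (Fin N → Bool) → Δ) (sOf : Δ → (Core.B4 → Bool))
    (gOf : Δ → Core.B4) (wOf : Δ → Bool)
    (hdat : ∀ x (k : Fin N), anc A x = {k} →
      sOf (dat x) = (fun ε => !decide (f k (orb b₁ b₂ b₃ b₄ ε x) = 1)) ∧
      gOf (dat x) = gvec b₁ b₂ b₃ b₄ k.val ∧ wOf (dat x) = decide (k.val = N - 1))
    (x : Fin N → Bool) (k : Fin N) (hk : anc A x = {k})
    (hks : k.val ≠ b₁ ∧ k.val ≠ b₂ ∧ k.val ≠ b₃ ∧ k.val ≠ b₄)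
    (hOS : ∀ ε, anc A (orb b₁ b₂ b₃ b₄ ε x) = anc A x) (hW : ∀ ε, CW A f (orb b₁ b₂ b₃ b₄ ε x)) :
    zvec b₁ b₂ b₃ b₄ x ∈ Zset sOf gOf wOf (dat x) := by
  obtain ⟨hs, hg, hw⟩ := hdat x k hk
  have hcw : ∀ ε, gCond (orb b₁ b₂ b₃ b₄ ε x)
      ((k.val + (if f k (orb b₁ b₂ b₃ b₄ ε x) = 1 then 0 else 1)) % N) := by
    intro ε
    obtain ⟨k', hk', hg'⟩ := hW ε
    rw [hOS ε, hk, Finset.singleton_inj] at hk'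
    subst hk'
    exact hg'
  unfold Zset
  rw [hw, hs]
  by_cases hkw : k.val = N - 1
  · rw [if_pos (decide_eq_true hkw), ← sgnVec_zero]
    refine orbit_law_wrap x h12 h23 h34 h4N _ fun ε => ?_
    have h := hcw ε
    rw [hkw] at h
    rw [tsel_eq]
    exact h
  · rw [if_neg (by rw [decide_eq_true_iff]; exact hkw), hg,
      show zvec b₁ b₂ b₃ b₄ x = xor4 (sgnVec b₁ b₂ b₃ b₄ x k.val) (gvec b₁ b₂ b₃ b₄ k.val) by
        rw [sgnVec_eq, xor4_xor4]]
    refine mem_image_of_mem _ (orbit_law_cert A f x h12 h23 h34 h4N k (by omega) hks (fun ε => ?_) fun ε => ?_)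
    · have hmemk : k ∈ anc A (orb b₁ b₂ b₃ b₄ ε x) := by rw [hOS ε, hk]; exact mem_singleton_self k
      exact (mem_filter.1 hmemk).2
    · exact ⟨k, (hOS ε).trans hk, hcw ε⟩

/-- **instability telescopes**: if the anchors change somewhere on the orbit, some orbit point is unstable under one
of the four single flips. -/
theorem unst_cover (A : Fin N → CubeFn (ZMod 3) N) {b₁ b₂ b₃ b₄ : ℕ} (h12 : b₁ + 2 ≤ b₂) (h23 : b₂ + 2 ≤ b₃)
    (h34 : b₃ + 2 ≤ b₄) (h4N : b₄ + 3 ≤ N) (x : Fin N → Bool) (hx : OddZeros x) (ε : Core.B4)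
    (hne : anc A (orb b₁ b₂ b₃ b₄ ε x) ≠ anc A x) :
    ∃ ε' : Core.B4, UB A b₁ (orb b₁ b₂ b₃ b₄ ε' x) ∨ UB A b₂ (orb b₁ b₂ b₃ b₄ ε' x) ∨
      UB A b₃ (orb b₁ b₂ b₃ b₄ ε' x) ∨ UB A b₄ (orb b₁ b₂ b₃ b₄ ε' x) := by
  have hodd : ∀ ε' : Core.B4, OddZeros (orb b₁ b₂ b₃ b₄ ε' x) := fun ε' =>
    (oddZeros_orb (by omega) (by omega) (by omega) (by omega) ε' x).2 hx
  obtain ⟨e₁, e₂, e₃, e₄⟩ := ε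
  by_cases h4 : anc A (orb b₁ b₂ b₃ b₄ (false, false, false, e₄) x) = anc A x
  · by_cases h3 : anc A (orb b₁ b₂ b₃ b₄ (false, false, e₃, e₄) x) = anc A x
    · by_cases h2 : anc A (orb b₁ b₂ b₃ b₄ (false, e₂, e₃, e₄) x) = anc A x
      · refine ⟨(false, e₂, e₃, e₄), Or.inl ⟨hodd _, ?_⟩⟩
        cases e₁
        · exact absurd h2 hne
        · apply anc_ne_exists
          show anc A (orb b₁ b₂ b₃ b₄ (true, e₂, e₃, e₄) x) ≠ _
          rw [h2]; exact hne
      · refine ⟨(false, false, e₃, e₄), Or.inr (Or.inl ⟨hodd _, ?_⟩)⟩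
        cases e₂
        · exact absurd h3 h2
        · apply anc_ne_exists
          show anc A (orb b₁ b₂ b₃ b₄ (false, true, e₃, e₄) x) ≠ _
          rw [h3]; exact h2
    · refine ⟨(false, false, false, e₄), Or.inr (Or.inr (Or.inl ⟨hodd _, ?_⟩))⟩
      cases e₃
      · exact absurd h4 h3
      · apply anc_ne_exists
        show anc A (orb b₁ b₂ b₃ b₄ (false, false, true, e₄) x) ≠ _
        rw [h4]; exact h3
  · refine ⟨(false, false, false, false), Or.inr (Or.inr (Or.inr ⟨hodd _, ?_⟩))⟩
    cases e₄
    · exact absurd rfl h4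
    · apply anc_ne_exists
      exact h4

/-- **the class count**: if on every datum class each sign pattern carries at most `1/32` of the class (`+ η`), the
inputs whose sign vector is compatible with their datum are at most `10/16` of the odd class (`+ 320·|Δ|·η`). -/
theorem card_big_le [Fintype Δ] [DecidableEq Δ] (dat : (Fin N → Bool) → Δ) (Z : Δ → Finset Core.B4)
    (hZ : ∀ δ, (Z δ).card ≤ 10)
    (zv : (Fin N → Bool) → Core.B4) (O : (Fin N → Bool) → Prop) [DecidablePred O] (η : ℕ)
    (hequi : ∀ δ z₀, 32 * (univ.filter fun x => O x ∧ dat x = δ ∧ zv x = z₀).card ≤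
      (univ.filter fun x => dat x = δ).card + 32 * η) :
    32 * (univ.filter fun x => O x ∧ zv x ∈ Z (dat x)).card ≤
      10 * Fintype.card (Fin N → Bool) + 320 * Fintype.card Δ * η := by
  have hsub : (univ.filter fun x => O x ∧ zv x ∈ Z (dat x)) ⊆
      univ.biUnion fun δ => (Z δ).biUnion fun z₀ => univ.filter fun x => O x ∧ dat x = δ ∧ zv x = z₀ := by
    intro x hx
    rw [mem_filter] at hx
    rw [mem_biUnion]
    refine ⟨dat x, mem_univ _, ?_⟩
    rw [mem_biUnion]
    exact ⟨zv x, hx.2.2, mem_filter.2 ⟨mem_univ _, hx.2.1, rfl, rfl⟩⟩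
  have h1 := card_le_card hsub
  have h2 : (univ.biUnion fun δ => (Z δ).biUnion fun z₀ =>
      univ.filter fun x : Fin N → Bool => O x ∧ dat x = δ ∧ zv x = z₀).card
      ≤ ∑ δ, ∑ z₀ ∈ Z δ, (univ.filter fun x : Fin N → Bool => O x ∧ dat x = δ ∧ zv x = z₀).card :=
    card_biUnion_le.trans (sum_le_sum fun δ _ => card_biUnion_le)
  have h3 : ∀ δ, 32 * ∑ z₀ ∈ Z δ, (univ.filter fun x : Fin N → Bool => O x ∧ dat x = δ ∧ zv x = z₀).card
      ≤ 10 * ((univ.filter fun x : Fin N → Bool => dat x = δ).card + 32 * η) := by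
    intro δ
    rw [mul_sum]
    calc ∑ z₀ ∈ Z δ, 32 * (univ.filter fun x : Fin N → Bool => O x ∧ dat x = δ ∧ zv x = z₀).card
        ≤ ∑ z₀ ∈ Z δ, ((univ.filter fun x : Fin N → Bool => dat x = δ).card + 32 * η) :=
          sum_le_sum fun z₀ _ => hequi δ z₀
      _ = (Z δ).card * ((univ.filter fun x : Fin N → Bool => dat x = δ).card + 32 * η) := by
          rw [sum_const, smul_eq_mul]
      _ ≤ 10 * ((univ.filter fun x : Fin N → Bool => dat x = δ).card + 32 * η) :=
          Nat.mul_le_mul_right _ (hZ δ)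
  have h4 : ∑ δ : Δ, (univ.filter fun x : Fin N → Bool => dat x = δ).card ≤ Fintype.card (Fin N → Bool) := by
    rw [sum_card_fiberwise_eq_card_filter]
    exact card_le_univ _
  have h5 : 32 * ∑ δ, ∑ z₀ ∈ Z δ, (univ.filter fun x : Fin N → Bool => O x ∧ dat x = δ ∧ zv x = z₀).card
      ≤ 10 * Fintype.card (Fin N → Bool) + 320 * Fintype.card Δ * η := by
    rw [mul_sum]
    calc ∑ δ, 32 * ∑ z₀ ∈ Z δ, (univ.filter fun x : Fin N → Bool => O x ∧ dat x = δ ∧ zv x = z₀).card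
        ≤ ∑ δ : Δ, 10 * ((univ.filter fun x : Fin N → Bool => dat x = δ).card + 32 * η) :=
          sum_le_sum fun δ _ => h3 δ
      _ = 10 * ∑ δ : Δ, (univ.filter fun x : Fin N → Bool => dat x = δ).card + 320 * Fintype.card Δ * η := by
          rw [← mul_sum, sum_add_distrib, sum_const, smul_eq_mul, card_univ]; ring
      _ ≤ 10 * Fintype.card (Fin N → Bool) + 320 * Fintype.card Δ * η :=
          Nat.add_le_add_right (Nat.mul_le_mul_left _ h4) _
  omega

/-- **THE COUNTING SHELL.**  For a certificate `(A, f)` and four separated flip sites, and ANY datum map `dat` into a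
finite type that reads the selector bits / gap vector / wrap flag correctly on uniquely anchored inputs (`hdat`),
the equidistribution hypothesis (EQUI) `hequi` — every sign pattern carries at most `1/32` of each datum class of
the whole cube, up to `η` — yields

`32·#odd ≤ 32·#(non-uniquely anchored) + 512·Σ_i #(unstable at site i) + 32·#(anchored at a site)`
`        + 10·2^n + 320·|Δ|·η + 512·#(odd, not certified-winning)`,

i.e. `#losers ≥ (12·2^{n-1} − junk)/512`.  What a prover supplies to reach `MovingPointerLoss3`: (E1) `dat` by
polylog-degree polynomials (`Σ_k selP(A_k)·selP(f_k)∘orb_ε`, `Σ_{k > b_i} selP(A_k)`, `selP(A_{n-1})`) with `hdat`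
and the degree of the class indicators; (E2) EQUI from Smolensky's bound for the five block parities between the
sites on a polylog-degree class (the g13 `chain4`/`pattern_bound` pattern with five blocks, `η ≈ 2^n·D'/√m`);
(E3) a placement `b_i = i·m + t` making `Σ_i #(unstable at b_i) ≤ n·2^{n-1}/(4096·m)` and `#(anchored at a site)
≤ 4·2^{n-1}/m` (averaging (STAB) and the anchor histogram over `t`); (E4) the asymptotic assembly. -/
theorem count_shell [Fintype Δ] [DecidableEq Δ] (A f : Fin N → CubeFn (ZMod 3) N) {b₁ b₂ b₃ b₄ : ℕ}
    (h12 : b₁ + 2 ≤ b₂) (h23 : b₂ + 2 ≤ b₃) (h34 : b₃ + 2 ≤ b₄) (h4N : b₄ + 3 ≤ N)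
    (dat : (Fin N → Bool) → Δ) (sOf : Δ → (Core.B4 → Bool))
    (gOf : Δ → Core.B4) (wOf : Δ → Bool)
    (hdat : ∀ x (k : Fin N), anc A x = {k} →
      sOf (dat x) = (fun ε => !decide (f k (orb b₁ b₂ b₃ b₄ ε x) = 1)) ∧
      gOf (dat x) = gvec b₁ b₂ b₃ b₄ k.val ∧ wOf (dat x) = decide (k.val = N - 1))
    (η : ℕ)
    (hequi : ∀ δ z₀, 32 * (univ.filter fun x => OddZeros x ∧ dat x = δ ∧ zvec b₁ b₂ b₃ b₄ x = z₀).card ≤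
      (univ.filter fun x => dat x = δ).card + 32 * η) :
    32 * (univ.filter fun x : Fin N → Bool => OddZeros x).card ≤
      32 * (univ.filter fun x : Fin N → Bool => OddZeros x ∧ (anc A x).card ≠ 1).card
      + 512 * ((univ.filter fun x => UB A b₁ x).card + (univ.filter fun x => UB A b₂ x).card
          + (univ.filter fun x => UB A b₃ x).card + (univ.filter fun x => UB A b₄ x).card)
      + 32 * (univ.filter fun x : Fin N → Bool => OddZeros x ∧
          ∃ k, anc A x = {k} ∧ (k.val = b₁ ∨ k.val = b₂ ∨ k.val = b₃ ∨ k.val = b₄)).card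
      + (10 * Fintype.card (Fin N → Bool) + 320 * Fintype.card Δ * η)
      + 512 * (univ.filter fun x : Fin N → Bool => OddZeros x ∧ ¬ CW A f x).card := by
  -- the five covering sets
  set NU := univ.filter fun x : Fin N → Bool => OddZeros x ∧ (anc A x).card ≠ 1 with hNU
  set UN := univ.filter fun x : Fin N → Bool => ∃ ε' : Core.B4, UB A b₁ (orb b₁ b₂ b₃ b₄ ε' x) ∨
    UB A b₂ (orb b₁ b₂ b₃ b₄ ε' x) ∨ UB A b₃ (orb b₁ b₂ b₃ b₄ ε' x) ∨ UB A b₄ (orb b₁ b₂ b₃ b₄ ε' x) with hUN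
  set SI := univ.filter fun x : Fin N → Bool => OddZeros x ∧
    ∃ k, anc A x = {k} ∧ (k.val = b₁ ∨ k.val = b₂ ∨ k.val = b₃ ∨ k.val = b₄) with hSI
  set BIG := univ.filter fun x : Fin N → Bool => OddZeros x ∧ zvec b₁ b₂ b₃ b₄ x ∈ Zset sOf gOf wOf (dat x)
    with hBIG
  set HL := univ.filter fun x : Fin N → Bool => ∃ ε : Core.B4,
    OddZeros (orb b₁ b₂ b₃ b₄ ε x) ∧ ¬ CW A f (orb b₁ b₂ b₃ b₄ ε x) with hHL
  -- cover of the odd class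
  have hcov : (univ.filter fun x : Fin N → Bool => OddZeros x) ⊆ NU ∪ UN ∪ SI ∪ BIG ∪ HL := by
    intro x hx
    rw [mem_filter] at hx
    have hodd := hx.2
    simp only [mem_union]
    by_cases hc : (anc A x).card = 1
    · obtain ⟨k, hk⟩ := card_eq_one.1 hc
      by_cases hos : ∀ ε, anc A (orb b₁ b₂ b₃ b₄ ε x) = anc A x
      · by_cases hsite : k.val = b₁ ∨ k.val = b₂ ∨ k.val = b₃ ∨ k.val = b₄
        · exact Or.inl (Or.inl (Or.inr (mem_filter.2 ⟨mem_univ _, hodd, k, hk, hsite⟩)))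
        · have hks : k.val ≠ b₁ ∧ k.val ≠ b₂ ∧ k.val ≠ b₃ ∧ k.val ≠ b₄ := by
            push Not at hsite
            exact hsite
          by_cases hall : ∀ ε, CW A f (orb b₁ b₂ b₃ b₄ ε x)
          · exact Or.inl (Or.inr (mem_filter.2 ⟨mem_univ _, hodd,
              full_mem A f h12 h23 h34 h4N dat sOf gOf wOf hdat x k hk hks hos hall⟩))
          · push Not at hall
            obtain ⟨ε, hε⟩ := hall
            exact Or.inr (mem_filter.2 ⟨mem_univ _, ε,
              (oddZeros_orb (by omega) (by omega) (by omega) (by omega) ε x).2 hodd, hε⟩)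
      · push Not at hos
        obtain ⟨ε, hε⟩ := hos
        exact Or.inl (Or.inl (Or.inl (Or.inr (mem_filter.2 ⟨mem_univ _,
          unst_cover A h12 h23 h34 h4N x hodd ε hε⟩))))
    · exact Or.inl (Or.inl (Or.inl (Or.inl (mem_filter.2 ⟨mem_univ _, hodd, hc⟩))))
  have hc1 := (card_le_card hcov).trans ((card_union_le _ _).trans (Nat.add_le_add_right
    ((card_union_le _ _).trans (Nat.add_le_add_right ((card_union_le _ _).trans (Nat.add_le_add_right
    (card_union_le _ _) _)) _)) _))
  -- instability
  have hUN4 : UN ⊆ (univ.filter fun x => ∃ ε' : Core.B4, UB A b₁ (orb b₁ b₂ b₃ b₄ ε' x)) ∪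
      (univ.filter fun x => ∃ ε' : Core.B4, UB A b₂ (orb b₁ b₂ b₃ b₄ ε' x)) ∪
      (univ.filter fun x => ∃ ε' : Core.B4, UB A b₃ (orb b₁ b₂ b₃ b₄ ε' x)) ∪
      (univ.filter fun x => ∃ ε' : Core.B4, UB A b₄ (orb b₁ b₂ b₃ b₄ ε' x)) := by
    intro x hx
    rw [hUN, mem_filter] at hx
    obtain ⟨ε', h⟩ := hx.2
    simp only [mem_union, mem_filter, mem_univ, true_and]
    rcases h with h | h | h | h
    · exact Or.inl (Or.inl (Or.inl ⟨ε', h⟩))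
    · exact Or.inl (Or.inl (Or.inr ⟨ε', h⟩))
    · exact Or.inl (Or.inr ⟨ε', h⟩)
    · exact Or.inr ⟨ε', h⟩
  have hu := (card_le_card hUN4).trans ((card_union_le _ _).trans (Nat.add_le_add_right
    ((card_union_le _ _).trans (Nat.add_le_add_right (card_union_le _ _) _)) _))
  have hu1 := card_exists_orb_le b₁ b₂ b₃ b₄ (UB A b₁)
  have hu2 := card_exists_orb_le b₁ b₂ b₃ b₄ (UB A b₂)
  have hu3 := card_exists_orb_le b₁ b₂ b₃ b₄ (UB A b₃)
  have hu4 := card_exists_orb_le b₁ b₂ b₃ b₄ (UB A b₄)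
  -- losers
  have hl : HL.card ≤ 16 * (univ.filter fun x : Fin N → Bool => OddZeros x ∧ ¬ CW A f x).card :=
    card_exists_orb_le b₁ b₂ b₃ b₄ (fun y : Fin N → Bool => OddZeros y ∧ ¬ CW A f y)
  -- the class count
  have hbig : 32 * BIG.card ≤ 10 * Fintype.card (Fin N → Bool) + 320 * Fintype.card Δ * η :=
    card_big_le dat (Zset sOf gOf wOf) (card_Zset_le sOf gOf wOf) (zvec b₁ b₂ b₃ b₄) OddZeros η hequi
  omega

end Count

end Summit.QuantumAdvantage.QuantumAdvantage.Theorems.AnchorDial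

end
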